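import Summits.QuantumFields.GaugeBoot.BootstrapReflectionPositivity
import HarnessLib

/-!
# Reflection positivity as bootstrap cuts II: the LINK reflection (gauge-boot, L1/L3 supplement)

HONEST FRAMING (cell `pub-gaugeboot`, page 1 of every file): the venture produces certified bounds
on lattice expectations at stated coupling, gauge group, dimension and torus size; NOT a mass gap,
NOT a continuum limit, NOT a string tension; NOT Yang–Mills-summit-bearing (barriers
`FixedCouplingUltralocality`, `PerturbativeInvisibility`). Structural; it certifies no number.

## Content

`BootstrapReflectionPositivity` treated the SITE reflection (any real `β`). The reflection used most
in the lattice bootstrap (Kazakov–Zheng §4) is the LINK reflection `Θ` in the hyperplane between two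
time slices (tree `GaugeConfig.timeReflect`, Osterwalder–Seiler S13
`wilsonExpectation_reflectionPositive_holds`: `β ≥ 0`, even `L`, positive-time observables
`IsPositiveTimeObservable`). As for the site reflection, these cuts are consequences of the untruncated
system:

* `timeReflectCM`, `comp_timeReflectCM_mem_polyAlgebra` — the link reflection as a continuous,
  polynomial-stable self-map (temporal links crossing the plane are reversed: unitarity
  `ρ(g⁻¹) = ρ(g)ᴴ`);
* `wilson_linkRP_real` — `0 ≤ ∫ f(ΘU) f(U) dμ_Wilson` for continuous real positive-time `f`, `β ≥ 0`;
* ★★★ `linkRP_of_bootstrap_suN` / `_uN` — every solution of the untruncated bootstrap satisfies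
  `0 ≤ φ ((f ∘ Θ) · f)` for positive-time polynomials `f` (`β ≥ 0`, even `L`);
  ★★ `linkRPGram_nonneg_of_bootstrap_suN` — the link-RP matrices are positive semi-definite;
* `linkRpLevelValuesSuN`, `wilson_mem_linkRpLevelValues_suN`, `linkRpLevelValues_subset_Icc_suN` — the
  word-length SDP with link-RP cuts keeps the Wilson value feasible (`β ≥ 0`) and converges.

What this is NOT: diagonal reflections (the cell's L3 files; same argument); odd `L`; `β < 0`.

References: K. Osterwalder, E. Seiler, Ann. Phys. 110 (1978) 440 §2; V. Kazakov, Z. Zheng,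
arXiv:2203.11360 §4. Folklore.
-/

noncomputable section

open MeasureTheory Filter Topology NormedSpace
open scoped ComplexOrder Matrix
open Literature.MathematicalPhysics.QuantumFieldTheory (LatticeRep Site Edge GaugeConfig IsPositiveTimeObservable wilsonAction
  wilsonMeasure wilsonExpectation isProbabilityMeasure_wilsonMeasure wilsonExpectation_reflectionPositive_holds)

namespace Summit.QuantumFields.GaugeBoot

/-! ## The link reflection as a continuous, polynomial-stable map -/

section Reflection

variable {d L : ℕ} [NeZero d] {G : Type*} [Group G] [TopologicalSpace G] [IsTopologicalGroup G]

/-- **The link reflection `Θ`** (in the hyperplane between the time slices `0 | 1`; spatial links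
carried along, temporal links crossing the plane reversed: tree `GaugeConfig.timeReflect`) as a
continuous self-map of the configurations. [folklore] -/
def timeReflectCM : C(GaugeConfig d L G, GaugeConfig d L G) where
  toFun := GaugeConfig.timeReflect
  continuous_toFun := by
    refine continuous_pi fun e => ?_
    by_cases h : e.2 = 0
    · simp only [GaugeConfig.timeReflect, h, if_true]
      exact (continuous_apply _).inv
    · simp only [GaugeConfig.timeReflect, h, if_false]
      exact continuous_apply _

/-- `timeReflectCM` is the tree's `GaugeConfig.timeReflect`. -/
@[simp] theorem timeReflectCM_apply (U : GaugeConfig d L G) : timeReflectCM U = U.timeReflect := rfl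

variable (r : LatticeRep G)

/-- **The polynomial observables are stable under the link reflection.** [folklore] -/
theorem comp_timeReflectCM_mem_polyAlgebra {f : C(GaugeConfig d L G, ℝ)} (hf : f ∈ polyAlgebra (ι := Edge d L) r) :
    f.comp timeReflectCM ∈ polyAlgebra (ι := Edge d L) r := by
  have h : polyAlgebra (ι := Edge d L) r ≤ (polyAlgebra (ι := Edge d L) r).comap
      (ContinuousMap.compRightAlgHom ℝ ℝ (timeReflectCM (G := G) (d := d) (L := L))) := by
    refine Algebra.adjoin_le ?_
    rintro _ (⟨⟨e, a, b⟩, rfl⟩ | ⟨⟨e, a, b⟩, rfl⟩)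
    · change (reEntry r e a b).comp timeReflectCM ∈ polyAlgebra (ι := Edge d L) r
      by_cases he : e.2 = 0
      · have : (reEntry r e a b).comp (timeReflectCM (G := G)) =
            reEntry r (((e.1.shift 0).timeReflect, 0) : Edge d L) b a := by
          ext U
          simp only [ContinuousMap.comp_apply, timeReflectCM_apply, reEntry_apply, GaugeConfig.timeReflect, he, if_true]
          exact (rho_inv_apply_re_im r _ a b).1
        rw [this]
        exact reEntry_mem r _ b a
      · have : (reEntry r e a b).comp (timeReflectCM (G := G)) = reEntry r ((e.1.timeReflect, e.2) : Edge d L) a b := by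
          ext U
          simp only [ContinuousMap.comp_apply, timeReflectCM_apply, reEntry_apply, GaugeConfig.timeReflect, he, if_false]
        rw [this]
        exact reEntry_mem r _ a b
    · change (imEntry r e a b).comp timeReflectCM ∈ polyAlgebra (ι := Edge d L) r
      by_cases he : e.2 = 0
      · have : (imEntry r e a b).comp (timeReflectCM (G := G)) =
            -imEntry r (((e.1.shift 0).timeReflect, 0) : Edge d L) b a := by
          ext U
          simp only [ContinuousMap.comp_apply, timeReflectCM_apply, imEntry_apply, GaugeConfig.timeReflect, he, if_true,
            ContinuousMap.neg_apply]
          exact (rho_inv_apply_re_im r _ a b).2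
        rw [this]
        exact Subalgebra.neg_mem _ (imEntry_mem r _ b a)
      · have : (imEntry r e a b).comp (timeReflectCM (G := G)) = imEntry r ((e.1.timeReflect, e.2) : Edge d L) a b := by
          ext U
          simp only [ContinuousMap.comp_apply, timeReflectCM_apply, imEntry_apply, GaugeConfig.timeReflect, he, if_false]
        rw [this]
        exact imEntry_mem r _ a b
  exact h hf

variable {N : ℕ} (ρ : G →* Matrix (Fin N) (Fin N) ℂ) [CompactSpace G] [MeasurableSpace G] [BorelSpace G]
  [SecondCountableTopology G] [NeZero L]

/-- **Link reflection positivity of the torus Wilson measure, real form** (`β ≥ 0`, even `L`; tree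
S13 `wilsonExpectation_reflectionPositive_holds`): `0 ≤ ∫ f(ΘU) f(U) dμ` for continuous real
positive-time `f`. [folklore] -/
theorem wilson_linkRP_real (hL : Even L) (hρ : Continuous ρ) {β : ℝ} (hβ : 0 ≤ β) (f : C(GaugeConfig d L G, ℝ))
    (hpos : IsPositiveTimeObservable (⇑f)) :
    0 ≤ ∫ U, f (timeReflectCM U) * f U ∂(wilsonMeasure (d := d) (L := L) ρ β) := by
  have h := wilsonExpectation_reflectionPositive_holds (d := d) (L := L) ρ hL hρ hβ (fun U => (f U : ℂ))
    (Complex.continuous_ofReal.comp f.continuous).measurable ⟨‖f‖, fun U => by simpa using f.norm_coe_le_norm U⟩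
    (fun U V hUV => by simp only [hpos U V hUV])
  simp only [wilsonExpectation, Complex.conj_ofReal, ← Complex.ofReal_mul] at h
  rw [integral_complex_ofReal] at h
  exact_mod_cast h

end Reflection

/-! ## Every solution satisfies the link-RP cuts -/

section Unitary

open Literature.MathematicalPhysics.QuantumLattice

variable {d L : ℕ} [NeZero d] [NeZero L] (N : ℕ) {β : ℝ}

/-- ★★★ **`SU(N)`, `β ≥ 0`, even `L`: every solution of the untruncated bootstrap is link-reflection
positive** — `0 ≤ φ ((f ∘ Θ) · f)` for every positive-time polynomial observable `f`. [folklore] -/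
theorem linkRP_of_bootstrap_suN (hL : Even L) (hβ : 0 ≤ β)
    {φ : C(GaugeConfig d L (Matrix.specialUnitaryGroup (Fin N) ℂ), ℝ) →ₗ[ℝ] ℝ} (h1 : φ 1 = 1)
    (hpos : ∀ a ∈ polyAlgebra (ι := Edge d L) (fundamentalLatticeRep N), 0 ≤ φ (a * a))
    (hφ : IsSDFunctional (fundamentalLatticeRep N) (suExp N) (fun _ => wilsonAction (fundamentalRep (Fin N))) β φ)
    {f : C(GaugeConfig d L (Matrix.specialUnitaryGroup (Fin N) ℂ), ℝ)}
    (hf : f ∈ polyAlgebra (ι := Edge d L) (fundamentalLatticeRep N)) (hft : IsPositiveTimeObservable (⇑f)) :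
    0 ≤ φ (f.comp timeReflectCM * f) := by
  rw [eq_wilson_of_bootstrap_suN N β h1 hpos hφ
    (Subalgebra.mul_mem _ (comp_timeReflectCM_mem_polyAlgebra _ hf) hf)]
  simpa only [ContinuousMap.mul_apply, ContinuousMap.comp_apply] using
    wilson_linkRP_real (fundamentalRep (Fin N)) hL (continuous_fundamentalRep _) hβ f hft

/-- ★★★ **`U(N)`, `β ≥ 0`, even `L`: every solution is link-reflection positive.** [folklore] -/
theorem linkRP_of_bootstrap_uN (hL : Even L) (hβ : 0 ≤ β)
    {φ : C(GaugeConfig d L (Matrix.unitaryGroup (Fin N) ℂ), ℝ) →ₗ[ℝ] ℝ} (h1 : φ 1 = 1)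
    (hpos : ∀ a ∈ polyAlgebra (ι := Edge d L) (unitaryFundamentalLatticeRep N), 0 ≤ φ (a * a))
    (hφ : IsSDFunctional (unitaryFundamentalLatticeRep N) (uExp N)
      (fun _ => wilsonAction (unitaryFundamentalRep (Fin N) ℂ)) β φ)
    {f : C(GaugeConfig d L (Matrix.unitaryGroup (Fin N) ℂ), ℝ)}
    (hf : f ∈ polyAlgebra (ι := Edge d L) (unitaryFundamentalLatticeRep N)) (hft : IsPositiveTimeObservable (⇑f)) :
    0 ≤ φ (f.comp timeReflectCM * f) := by
  rw [eq_wilson_of_bootstrap_uN N β h1 hpos hφ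
    (Subalgebra.mul_mem _ (comp_timeReflectCM_mem_polyAlgebra _ hf) hf)]
  simpa only [ContinuousMap.mul_apply, ContinuousMap.comp_apply] using
    wilson_linkRP_real (unitaryFundamentalRep (Fin N) ℂ) hL (continuous_unitaryFundamentalRep _ _) hβ f hft

/-- ★★ **The link-RP matrices of a solution are positive semi-definite** (real quadratic form).
[folklore] -/
theorem linkRPGram_nonneg_of_bootstrap_suN (hL : Even L) (hβ : 0 ≤ β) {κ : Type*} [Fintype κ]
    {φ : C(GaugeConfig d L (Matrix.specialUnitaryGroup (Fin N) ℂ), ℝ) →ₗ[ℝ] ℝ} (h1 : φ 1 = 1)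
    (hpos : ∀ a ∈ polyAlgebra (ι := Edge d L) (fundamentalLatticeRep N), 0 ≤ φ (a * a))
    (hφ : IsSDFunctional (fundamentalLatticeRep N) (suExp N) (fun _ => wilsonAction (fundamentalRep (Fin N))) β φ)
    (f : κ → C(GaugeConfig d L (Matrix.specialUnitaryGroup (Fin N) ℂ), ℝ))
    (hf : ∀ k, f k ∈ polyAlgebra (ι := Edge d L) (fundamentalLatticeRep N))
    (hft : ∀ k, IsPositiveTimeObservable (⇑(f k))) (c : κ → ℝ) :
    0 ≤ ∑ j, ∑ k, c j * c k * φ ((f j).comp timeReflectCM * f k) := by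
  set g : C(GaugeConfig d L (Matrix.specialUnitaryGroup (Fin N) ℂ), ℝ) := ∑ k, c k • f k with hg
  have hgm : g ∈ polyAlgebra (ι := Edge d L) (fundamentalLatticeRep N) :=
    Subalgebra.sum_mem _ fun k _ => Subalgebra.smul_mem _ (hf k) _
  have hgt : IsPositiveTimeObservable (⇑g) := by
    intro U V hUV
    simp only [hg, ContinuousMap.coe_sum, ContinuousMap.coe_smul, Finset.sum_apply, Pi.smul_apply]
    exact Finset.sum_congr rfl fun k _ => by rw [hft k U V hUV]
  have h := linkRP_of_bootstrap_suN N hL hβ h1 hpos hφ hgm hgt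
  have hexp : g.comp timeReflectCM * g = ∑ j, ∑ k, (c j * c k) • ((f j).comp timeReflectCM * f k) := by
    rw [hg, ContinuousMap.ext_iff]
    intro U
    simp only [ContinuousMap.mul_apply, ContinuousMap.comp_apply, ContinuousMap.coe_sum, ContinuousMap.coe_smul,
      Finset.sum_apply, Pi.smul_apply, smul_eq_mul]
    rw [Finset.sum_mul]
    refine Finset.sum_congr rfl fun j _ => ?_
    rw [Finset.mul_sum]
    refine Finset.sum_congr rfl fun k _ => ?_
    ring
  rw [hexp, map_sum] at h
  simpa only [map_sum, map_smul, smul_eq_mul] using h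

variable (β)

/-- **The level-`n` feasible values of `P` with the link-RP cuts added.** [folklore] -/
def linkRpLevelValuesSuN (n : ℕ) (P : C(GaugeConfig d L (Matrix.specialUnitaryGroup (Fin N) ℂ), ℝ)) : Set ℝ :=
  {t | ∃ φ : C(GaugeConfig d L (Matrix.specialUnitaryGroup (Fin N) ℂ), ℝ) →ₗ[ℝ] ℝ,
    IsBootstrapFeasible (fundamentalLatticeRep N) (suExp N)
        (fun _ => wilsonAction (fundamentalRep (Fin N))) β
        (wordTruncation (ι := Edge d L) (fundamentalLatticeRep N) n) φ ∧
      (∀ v ∈ wordTruncation (ι := Edge d L) (fundamentalLatticeRep N) n,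
        IsPositiveTimeObservable (⇑v) → 0 ≤ φ (v.comp timeReflectCM * v)) ∧
      φ P = t}

/-- The link-RP cuts shrink the feasible set. -/
theorem linkRpLevelValues_subset_levelValues (n : ℕ) (P : C(GaugeConfig d L (Matrix.specialUnitaryGroup (Fin N) ℂ), ℝ)) :
    linkRpLevelValuesSuN (d := d) (L := L) N β n P ⊆ levelValuesSuN (d := d) (L := L) N β n P := by
  rintro t ⟨φ, hφ, -, rfl⟩
  exact ⟨φ, hφ, rfl⟩

/-- ★★ **The Wilson value satisfies the link-RP cuts at every level** (`β ≥ 0`, even `L`). [folklore] -/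
theorem wilson_mem_linkRpLevelValues_suN (hL : Even L) (hβ : 0 ≤ β) (n : ℕ)
    (P : C(GaugeConfig d L (Matrix.specialUnitaryGroup (Fin N) ℂ), ℝ)) :
    ∫ U, P U ∂(wilsonMeasure (fundamentalRep (Fin N)) β) ∈ linkRpLevelValuesSuN (d := d) (L := L) N β n P := by
  haveI : IsProbabilityMeasure (wilsonMeasure (d := d) (L := L) (fundamentalRep (Fin N)) β) :=
    isProbabilityMeasure_wilsonMeasure (ρ := fundamentalRep (Fin N)) (continuous_fundamentalRep _) β
  refine ⟨expectationFunctional (wilsonMeasure (fundamentalRep (Fin N)) β),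
    isBootstrapFeasible_wilson_suN N β _ rfl (wordTruncation_subset_polyAlgebra _ n), fun v _ hvt => ?_, rfl⟩
  rw [expectationFunctional_apply]
  simpa only [ContinuousMap.mul_apply, ContinuousMap.comp_apply] using
    wilson_linkRP_real (fundamentalRep (Fin N)) hL (continuous_fundamentalRep _) hβ v hvt

/-- ★★ **The SDP bounds with link-RP cuts converge to the Wilson value.** [folklore] -/
theorem linkRpLevelValues_subset_Icc_suN {P : C(GaugeConfig d L (Matrix.specialUnitaryGroup (Fin N) ℂ), ℝ)}
    (hP : P ∈ polyAlgebra (ι := Edge d L) (fundamentalLatticeRep N)) {ε : ℝ} (hε : 0 < ε) :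
    ∀ᶠ n in atTop, linkRpLevelValuesSuN (d := d) (L := L) N β n P ⊆
      Set.Icc (∫ U, P U ∂(wilsonMeasure (fundamentalRep (Fin N)) β) - ε)
        (∫ U, P U ∂(wilsonMeasure (fundamentalRep (Fin N)) β) + ε) := by
  filter_upwards [levelValues_subset_Icc_suN N β hP hε] with n hn
  exact (linkRpLevelValues_subset_levelValues N β n P).trans hn

end Unitary

end Summit.QuantumFields.GaugeBoot

end
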